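import Summits.ValiantsHypothesis.ValiantsHypothesis.Theorems.SymPencilOriginMoments

/-!
# Route `SymPencil` — the THIRD origin moment of a symmetric determinantal representation of a quartic
# (second typed identity of the `r = 12` branch past `sdc(per_4) ≥ 25`, `--supports` stmt-ValiantsHypothesis-5674)

Continuation of `SymPencilOriginMoments.moments_four`.  From
`det [[s a₀, s b₀ᵀ], [s b₀, D + s C₀]] = κ s⁴ φ` for all `s` (`D` invertible) that file reads off the
coefficients of `X, …, X⁴`; here we read off the coefficient of `X⁵` (`moment_four_third`):

  `b₀ᵀ D⁻¹ (C₀ D⁻¹)³ b₀ = d₁ · b₀ᵀ D⁻¹ (C₀ D⁻¹)² b₀`,   `d₁` = the `X`-coefficient of `det (1 + X D⁻¹C₀)`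

(i.e. `μ₃ = tr(D⁻¹C₀) · μ₂`, the third moment is the trace times the second, which is the quartic
itself up to `-κ/det D`).  Tools: the third coefficient of `adj (1 + X T)`
(`map_coeff_adjugate_one_add_three`, from the recursion
`SymPencilAdjugateExpansion.map_coeff_adjugate_one_add_rel`) and of `bᵀ adj (D + X N) b'`
(`coeff_bilin_adjugate_line_three`).  This is one of the identities beyond the `s²`-coefficient that
the `r = 12` case (`V = ` one row, where every Hessian count is void) has to be attacked with
(crux note NEXT-RUNG (G)); nothing here bears on `VP ≠ VNP`. [folklore]
-/

noncomputable section

-- single-conjunct layout: Sub = Summit, duplicated namespace component intended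
set_option linter.dupNamespace false

namespace Summit.ValiantsHypothesis.ValiantsHypothesis.Theorems.SymPencilOriginMomentsThird

open Matrix Polynomial
open Summit.ValiantsHypothesis.ValiantsHypothesis.Theorems.SymPencilHomogeneousDropTools
open Summit.ValiantsHypothesis.ValiantsHypothesis.Theorems.SymPencilAdjugateExpansion
open Summit.ValiantsHypothesis.ValiantsHypothesis.Theorems.SymPencilOriginMoments

universe u

variable {k : Type u} [Field k] {ι : Type*} [Fintype ι] [DecidableEq ι]

/-- **Third coefficient of `adj (1 + X T)`**: `𝔞₃ = d₃ • 1 - d₂ • T + d₁ • T² - T³`. [folklore] -/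
theorem map_coeff_adjugate_one_add_three (T : Matrix ι ι k) :
    (adjugate (1 + (Polynomial.X : k[X]) • T.map Polynomial.C)).map (fun p : k[X] => p.coeff 3) =
      (det (1 + (Polynomial.X : k[X]) • T.map Polynomial.C)).coeff 3 • (1 : Matrix ι ι k) -
        (det (1 + (Polynomial.X : k[X]) • T.map Polynomial.C)).coeff 2 • T +
        (det (1 + (Polynomial.X : k[X]) • T.map Polynomial.C)).coeff 1 • (T * T) - T * T * T := by
  obtain ⟨-, hs⟩ := map_coeff_adjugate_one_add_rel T
  obtain ⟨-, -, h2⟩ := map_coeff_adjugate_one_add T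
  have h3 := hs 2
  rw [h2] at h3
  have h3' := eq_sub_of_add_eq h3
  rw [h3']
  simp only [Matrix.sub_mul, Matrix.add_mul, Matrix.smul_mul, Matrix.one_mul]
  abel

/-- **The coefficient of `X³` in `bᵀ adj (D + X N) b'`** (invertible `D`):
`g₃ = det D · (d₃ μ₀ - d₂ μ₁ + d₁ μ₂ - μ₃)` with `μ_j = bᵀ D⁻¹ (N D⁻¹)^j b'` and `d_j` the
coefficients of `det (1 + X D⁻¹ N)`. [folklore] -/
theorem coeff_bilin_adjugate_line_three {D : Matrix ι ι k} (hD : IsUnit D.det) (N : Matrix ι ι k)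
    (b b' : ι → k) :
    ((fun i => Polynomial.C (b i)) ⬝ᵥ
        adjugate (D.map Polynomial.C + (Polynomial.X : k[X]) • N.map Polynomial.C) *ᵥ
        (fun i => Polynomial.C (b' i))).coeff 3 =
      D.det * ((det (1 + (Polynomial.X : k[X]) • (D⁻¹ * N).map Polynomial.C)).coeff 3 *
          (b ⬝ᵥ D⁻¹ *ᵥ b') -
        (det (1 + (Polynomial.X : k[X]) • (D⁻¹ * N).map Polynomial.C)).coeff 2 *
          (b ⬝ᵥ (D⁻¹ * N * D⁻¹) *ᵥ b') +
        (det (1 + (Polynomial.X : k[X]) • (D⁻¹ * N).map Polynomial.C)).coeff 1 *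
          (b ⬝ᵥ (D⁻¹ * N * D⁻¹ * N * D⁻¹) *ᵥ b') -
        b ⬝ᵥ (D⁻¹ * N * D⁻¹ * N * D⁻¹ * N * D⁻¹) *ᵥ b') := by
  set T : Matrix ι ι k := D⁻¹ * N with hT
  have h3 := map_coeff_adjugate_one_add_three T
  have hadj : adjugate D = D.det • D⁻¹ := by
    rw [Matrix.nonsing_inv_apply _ hD, smul_smul, IsUnit.mul_val_inv, one_smul]
  set d₁ : k := (det (1 + (Polynomial.X : k[X]) • T.map Polynomial.C)).coeff 1 with hd₁
  set d₂ : k := (det (1 + (Polynomial.X : k[X]) • T.map Polynomial.C)).coeff 2 with hd₂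
  set d₃ : k := (det (1 + (Polynomial.X : k[X]) • T.map Polynomial.C)).coeff 3 with hd₃
  have hM3 : (d₃ • (1 : Matrix ι ι k) - d₂ • T + d₁ • (T * T) - T * T * T) * D⁻¹ =
      d₃ • D⁻¹ - d₂ • (D⁻¹ * N * D⁻¹) + d₁ • (D⁻¹ * N * D⁻¹ * N * D⁻¹) -
        D⁻¹ * N * D⁻¹ * N * D⁻¹ * N * D⁻¹ := by
    rw [Matrix.sub_mul, Matrix.add_mul, Matrix.sub_mul, Matrix.smul_mul, Matrix.smul_mul,
      Matrix.smul_mul, Matrix.one_mul, hT]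
    simp only [Matrix.mul_assoc]
  rw [coeff_cvec_dotProduct_mulVec, adjugate_line_eq hD, map_coeff_mul_map_C, hadj,
    Matrix.mul_smul, Matrix.smul_mulVec, dotProduct_smul, smul_eq_mul, h3, hM3,
    Matrix.sub_mulVec, Matrix.add_mulVec, Matrix.sub_mulVec, dotProduct_sub, dotProduct_add,
    dotProduct_sub, Matrix.smul_mulVec, dotProduct_smul, Matrix.smul_mulVec, dotProduct_smul,
    Matrix.smul_mulVec, dotProduct_smul, smul_eq_mul, smul_eq_mul, smul_eq_mul]

variable [CharZero k]

/-- **The third origin moment**: under the determinant identity (E) of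
`SymPencilOriginMoments.moments_four`, `μ₃ = d₁ μ₂`, i.e.
`b₀ᵀ D⁻¹C₀D⁻¹C₀D⁻¹C₀D⁻¹ b₀ = d₁ · b₀ᵀ D⁻¹C₀D⁻¹C₀D⁻¹ b₀` with `d₁` the `X`-coefficient of
`det (1 + X D⁻¹C₀)`. [folklore] -/
theorem moment_four_third {D C₀ : Matrix ι ι k} (hD : IsUnit D.det) (a₀ κ φ : k) (b₀ : ι → k)
    (hE : ∀ s : k, (Matrix.fromBlocks ((s * a₀) • (1 : Matrix Unit Unit k))
        (Matrix.replicateRow Unit (s • b₀)) (Matrix.replicateCol Unit (s • b₀)) (D + s • C₀)).det =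
        κ * s ^ 4 * φ) :
    b₀ ⬝ᵥ (D⁻¹ * C₀ * D⁻¹ * C₀ * D⁻¹ * C₀ * D⁻¹) *ᵥ b₀ =
      (det (1 + (Polynomial.X : k[X]) • (D⁻¹ * C₀).map Polynomial.C)).coeff 1 *
        (b₀ ⬝ᵥ (D⁻¹ * C₀ * D⁻¹ * C₀ * D⁻¹) *ᵥ b₀) := by
  classical
  obtain ⟨ha, hi, hii, -⟩ := moments_four hD a₀ κ φ b₀ hE
  have hD0 : D.det ≠ 0 := hD.ne_zero
  -- the two polynomials in play (as in `moments_four`)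
  set δ : k[X] := (D.map Polynomial.C + (Polynomial.X : k[X]) • C₀.map Polynomial.C).det with hδ
  set g : k[X] := (fun i => Polynomial.C (b₀ i)) ⬝ᵥ
      adjugate (D.map Polynomial.C + (Polynomial.X : k[X]) • C₀.map Polynomial.C) *ᵥ
      (fun i => Polynomial.C (b₀ i)) with hg
  set Q : k[X] := Polynomial.C a₀ * (Polynomial.X ^ 1 * δ) - Polynomial.X ^ 2 * g -
      Polynomial.C (κ * φ) * Polynomial.X ^ 4 with hQ
  have hroot : ∀ s : k, (D + s • C₀).det ≠ 0 → Q.IsRoot s := by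
    intro s hs
    have hSu : IsUnit (D + s • C₀).det := isUnit_iff_ne_zero.2 hs
    have h1 := hE s
    rw [det_fromBlocks_border hSu, Matrix.mulVec_smul, dotProduct_smul, smul_dotProduct,
      smul_eq_mul, smul_eq_mul] at h1
    have hadj : b₀ ⬝ᵥ adjugate (D + s • C₀) *ᵥ b₀ =
        (D + s • C₀).det * (b₀ ⬝ᵥ (D + s • C₀)⁻¹ *ᵥ b₀) := by
      have : adjugate (D + s • C₀) = (D + s • C₀).det • (D + s • C₀)⁻¹ := by
        rw [Matrix.nonsing_inv_apply _ hSu, smul_smul, IsUnit.mul_val_inv, one_smul]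
      rw [this, Matrix.smul_mulVec, dotProduct_smul, smul_eq_mul]
    rw [Polynomial.IsRoot.def, hQ]
    simp only [Polynomial.eval_sub, Polynomial.eval_mul, Polynomial.eval_C, Polynomial.eval_X,
      Polynomial.eval_pow]
    rw [hδ, eval_detLine, hg, eval_bilin_adjugate_line, hadj]
    linear_combination h1
  have hQ0 : Q = 0 := by
    apply Polynomial.eq_zero_of_infinite_isRoot
    have hδ0 : δ ≠ 0 := by
      intro h
      have h0 := coeff_detLine_zero D C₀
      rw [← hδ, h, Polynomial.coeff_zero] at h0
      exact hD0 h0.symm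
    have hfin : Set.Finite {s : k | δ.IsRoot s} := (δ.roots.toFinset.finite_toSet).subset
      fun s hs => by
        simp only [Set.mem_setOf_eq] at hs
        simp only [Finset.mem_coe, Multiset.mem_toFinset, Polynomial.mem_roots hδ0]
        exact hs
    refine (hfin.infinite_compl).mono fun s hs => ?_
    simp only [Set.mem_compl_iff, Set.mem_setOf_eq, Polynomial.IsRoot.def, hδ, eval_detLine] at hs
    exact hroot s hs
  -- the coefficient of `X⁵`: `-g₃ = 0`
  have hc5 : Q.coeff 5 = 0 := by rw [hQ0, Polynomial.coeff_zero]
  have hQ5 : Q.coeff 5 = a₀ * δ.coeff 4 - g.coeff 3 := by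
    rw [hQ, Polynomial.coeff_sub, Polynomial.coeff_sub, Polynomial.coeff_C_mul,
      Polynomial.coeff_X_pow_mul', Polynomial.coeff_X_pow_mul', Polynomial.coeff_C_mul_X_pow]
    norm_num
  rw [hQ5, ha, zero_mul, zero_sub, neg_eq_zero, hg, coeff_bilin_adjugate_line_three hD,
    hi, hii, mul_zero, mul_zero, zero_sub, add_comm] at hc5
  have h := (mul_eq_zero.1 hc5).resolve_left hD0
  linear_combination (-1 : k) * h

/-! ### Appended: the fourth coefficient and the fourth origin moment -/

omit [CharZero k] in
/-- **Fourth coefficient of `adj (1 + X T)`**: `𝔞₄ = d₄ • 1 - d₃ • T + d₂ • T² - d₁ • T³ + T⁴`.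
[folklore] -/
theorem map_coeff_adjugate_one_add_four (T : Matrix ι ι k) :
    (adjugate (1 + (Polynomial.X : k[X]) • T.map Polynomial.C)).map (fun p : k[X] => p.coeff 4) =
      (det (1 + (Polynomial.X : k[X]) • T.map Polynomial.C)).coeff 4 • (1 : Matrix ι ι k) -
        (det (1 + (Polynomial.X : k[X]) • T.map Polynomial.C)).coeff 3 • T +
        (det (1 + (Polynomial.X : k[X]) • T.map Polynomial.C)).coeff 2 • (T * T) -
        (det (1 + (Polynomial.X : k[X]) • T.map Polynomial.C)).coeff 1 • (T * T * T) +
        T * T * T * T := by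
  obtain ⟨-, hs⟩ := map_coeff_adjugate_one_add_rel T
  have h3 := map_coeff_adjugate_one_add_three T
  have h4 := hs 3
  rw [h3] at h4
  have h4' := eq_sub_of_add_eq h4
  rw [h4']
  simp only [Matrix.sub_mul, Matrix.add_mul, Matrix.smul_mul, Matrix.one_mul]
  abel

omit [CharZero k] in
/-- **The coefficient of `X⁴` in `bᵀ adj (D + X N) b'`** (invertible `D`):
`g₄ = det D · (d₄ μ₀ - d₃ μ₁ + d₂ μ₂ - d₁ μ₃ + μ₄)`. [folklore] -/
theorem coeff_bilin_adjugate_line_four {D : Matrix ι ι k} (hD : IsUnit D.det) (N : Matrix ι ι k)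
    (b b' : ι → k) :
    ((fun i => Polynomial.C (b i)) ⬝ᵥ
        adjugate (D.map Polynomial.C + (Polynomial.X : k[X]) • N.map Polynomial.C) *ᵥ
        (fun i => Polynomial.C (b' i))).coeff 4 =
      D.det * ((det (1 + (Polynomial.X : k[X]) • (D⁻¹ * N).map Polynomial.C)).coeff 4 *
          (b ⬝ᵥ D⁻¹ *ᵥ b') -
        (det (1 + (Polynomial.X : k[X]) • (D⁻¹ * N).map Polynomial.C)).coeff 3 *
          (b ⬝ᵥ (D⁻¹ * N * D⁻¹) *ᵥ b') +
        (det (1 + (Polynomial.X : k[X]) • (D⁻¹ * N).map Polynomial.C)).coeff 2 *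
          (b ⬝ᵥ (D⁻¹ * N * D⁻¹ * N * D⁻¹) *ᵥ b') -
        (det (1 + (Polynomial.X : k[X]) • (D⁻¹ * N).map Polynomial.C)).coeff 1 *
          (b ⬝ᵥ (D⁻¹ * N * D⁻¹ * N * D⁻¹ * N * D⁻¹) *ᵥ b') +
        b ⬝ᵥ (D⁻¹ * N * D⁻¹ * N * D⁻¹ * N * D⁻¹ * N * D⁻¹) *ᵥ b') := by
  set T : Matrix ι ι k := D⁻¹ * N with hT
  have h4 := map_coeff_adjugate_one_add_four T
  have hadj : adjugate D = D.det • D⁻¹ := by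
    rw [Matrix.nonsing_inv_apply _ hD, smul_smul, IsUnit.mul_val_inv, one_smul]
  set d₁ : k := (det (1 + (Polynomial.X : k[X]) • T.map Polynomial.C)).coeff 1 with hd₁
  set d₂ : k := (det (1 + (Polynomial.X : k[X]) • T.map Polynomial.C)).coeff 2 with hd₂
  set d₃ : k := (det (1 + (Polynomial.X : k[X]) • T.map Polynomial.C)).coeff 3 with hd₃
  set d₄ : k := (det (1 + (Polynomial.X : k[X]) • T.map Polynomial.C)).coeff 4 with hd₄
  have hM4 : (d₄ • (1 : Matrix ι ι k) - d₃ • T + d₂ • (T * T) - d₁ • (T * T * T) + T * T * T * T) *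
      D⁻¹ = d₄ • D⁻¹ - d₃ • (D⁻¹ * N * D⁻¹) + d₂ • (D⁻¹ * N * D⁻¹ * N * D⁻¹) -
        d₁ • (D⁻¹ * N * D⁻¹ * N * D⁻¹ * N * D⁻¹) + D⁻¹ * N * D⁻¹ * N * D⁻¹ * N * D⁻¹ * N * D⁻¹ := by
    rw [Matrix.add_mul, Matrix.sub_mul, Matrix.add_mul, Matrix.sub_mul, Matrix.smul_mul,
      Matrix.smul_mul, Matrix.smul_mul, Matrix.smul_mul, Matrix.one_mul, hT]
    simp only [Matrix.mul_assoc]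
  rw [coeff_cvec_dotProduct_mulVec, adjugate_line_eq hD, map_coeff_mul_map_C, hadj,
    Matrix.mul_smul, Matrix.smul_mulVec, dotProduct_smul, smul_eq_mul, h4, hM4,
    Matrix.add_mulVec, Matrix.sub_mulVec, Matrix.add_mulVec, Matrix.sub_mulVec, dotProduct_add,
    dotProduct_sub, dotProduct_add, dotProduct_sub, Matrix.smul_mulVec, dotProduct_smul,
    Matrix.smul_mulVec, dotProduct_smul, Matrix.smul_mulVec, dotProduct_smul, Matrix.smul_mulVec,
    dotProduct_smul, smul_eq_mul, smul_eq_mul, smul_eq_mul, smul_eq_mul]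

/-- **The fourth origin moment**: under (E), `μ₄ = d₁ μ₃ - d₂ μ₂` (`= (d₁² - d₂) μ₂` by
`moment_four_third`), with `μ_j = b₀ᵀ D⁻¹ (C₀ D⁻¹)^j b₀` and `d_j` the coefficients of
`det (1 + X D⁻¹C₀)`. [folklore] -/
theorem moment_four_fourth {D C₀ : Matrix ι ι k} (hD : IsUnit D.det) (a₀ κ φ : k) (b₀ : ι → k)
    (hE : ∀ s : k, (Matrix.fromBlocks ((s * a₀) • (1 : Matrix Unit Unit k))
        (Matrix.replicateRow Unit (s • b₀)) (Matrix.replicateCol Unit (s • b₀)) (D + s • C₀)).det =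
        κ * s ^ 4 * φ) :
    b₀ ⬝ᵥ (D⁻¹ * C₀ * D⁻¹ * C₀ * D⁻¹ * C₀ * D⁻¹ * C₀ * D⁻¹) *ᵥ b₀ =
      (det (1 + (Polynomial.X : k[X]) • (D⁻¹ * C₀).map Polynomial.C)).coeff 1 *
          (b₀ ⬝ᵥ (D⁻¹ * C₀ * D⁻¹ * C₀ * D⁻¹ * C₀ * D⁻¹) *ᵥ b₀) -
        (det (1 + (Polynomial.X : k[X]) • (D⁻¹ * C₀).map Polynomial.C)).coeff 2 *
          (b₀ ⬝ᵥ (D⁻¹ * C₀ * D⁻¹ * C₀ * D⁻¹) *ᵥ b₀) := by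
  classical
  obtain ⟨ha, hi, hii, -⟩ := moments_four hD a₀ κ φ b₀ hE
  have hD0 : D.det ≠ 0 := hD.ne_zero
  set δ : k[X] := (D.map Polynomial.C + (Polynomial.X : k[X]) • C₀.map Polynomial.C).det with hδ
  set g : k[X] := (fun i => Polynomial.C (b₀ i)) ⬝ᵥ
      adjugate (D.map Polynomial.C + (Polynomial.X : k[X]) • C₀.map Polynomial.C) *ᵥ
      (fun i => Polynomial.C (b₀ i)) with hg
  set Q : k[X] := Polynomial.C a₀ * (Polynomial.X ^ 1 * δ) - Polynomial.X ^ 2 * g -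
      Polynomial.C (κ * φ) * Polynomial.X ^ 4 with hQ
  have hroot : ∀ s : k, (D + s • C₀).det ≠ 0 → Q.IsRoot s := by
    intro s hs
    have hSu : IsUnit (D + s • C₀).det := isUnit_iff_ne_zero.2 hs
    have h1 := hE s
    rw [det_fromBlocks_border hSu, Matrix.mulVec_smul, dotProduct_smul, smul_dotProduct,
      smul_eq_mul, smul_eq_mul] at h1
    have hadj : b₀ ⬝ᵥ adjugate (D + s • C₀) *ᵥ b₀ =
        (D + s • C₀).det * (b₀ ⬝ᵥ (D + s • C₀)⁻¹ *ᵥ b₀) := by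
      have : adjugate (D + s • C₀) = (D + s • C₀).det • (D + s • C₀)⁻¹ := by
        rw [Matrix.nonsing_inv_apply _ hSu, smul_smul, IsUnit.mul_val_inv, one_smul]
      rw [this, Matrix.smul_mulVec, dotProduct_smul, smul_eq_mul]
    rw [Polynomial.IsRoot.def, hQ]
    simp only [Polynomial.eval_sub, Polynomial.eval_mul, Polynomial.eval_C, Polynomial.eval_X,
      Polynomial.eval_pow]
    rw [hδ, eval_detLine, hg, eval_bilin_adjugate_line, hadj]
    linear_combination h1
  have hQ0 : Q = 0 := by
    apply Polynomial.eq_zero_of_infinite_isRoot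
    have hδ0 : δ ≠ 0 := by
      intro h
      have h0 := coeff_detLine_zero D C₀
      rw [← hδ, h, Polynomial.coeff_zero] at h0
      exact hD0 h0.symm
    have hfin : Set.Finite {s : k | δ.IsRoot s} := (δ.roots.toFinset.finite_toSet).subset
      fun s hs => by
        simp only [Set.mem_setOf_eq] at hs
        simp only [Finset.mem_coe, Multiset.mem_toFinset, Polynomial.mem_roots hδ0]
        exact hs
    refine (hfin.infinite_compl).mono fun s hs => ?_
    simp only [Set.mem_compl_iff, Set.mem_setOf_eq, Polynomial.IsRoot.def, hδ, eval_detLine] at hs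
    exact hroot s hs
  -- the coefficient of `X⁶`: `-g₄ = 0`
  have hc6 : Q.coeff 6 = 0 := by rw [hQ0, Polynomial.coeff_zero]
  have hQ6 : Q.coeff 6 = a₀ * δ.coeff 5 - g.coeff 4 := by
    rw [hQ, Polynomial.coeff_sub, Polynomial.coeff_sub, Polynomial.coeff_C_mul,
      Polynomial.coeff_X_pow_mul', Polynomial.coeff_X_pow_mul', Polynomial.coeff_C_mul_X_pow]
    norm_num
  rw [hQ6, ha, zero_mul, zero_sub, neg_eq_zero, hg, coeff_bilin_adjugate_line_four hD,
    hi, hii, mul_zero, mul_zero, zero_sub] at hc6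
  have h := (mul_eq_zero.1 hc6).resolve_left hD0
  linear_combination h

end Summit.ValiantsHypothesis.ValiantsHypothesis.Theorems.SymPencilOriginMomentsThird

end
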